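import Summits.AtomisticToContinuum.Crystallization.Theses.PalmUnimodularRigidity
import Summits.AtomisticToContinuum.Crystallization.Theorems.MinimiserShells.Negative.LoadBearing
import Summits.AtomisticToContinuum.Crystallization.Theorems.MinimiserShells.Negative.Rootedness
import Summits.AtomisticToContinuum.Crystallization.Theorems.PalmUnimodularRigidityMinimiserShellsEquilibriumInLawAssembly
import Literature.Probability.Process.PointStationaryLaw
import Literature.MathematicalPhysics.StatisticalMechanics.RootEnergy
import Literature.MathematicalPhysics.StatisticalMechanics.MuGSC

/-!
# Event transfer I (cell level): the per-cell and pointwise inequalities for a priced event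

Helper file for stub `stub_pricingTransfer` (S8) of line `equilibrium-in-law-surgery` (lead reshape r3),
crux `MinimiserShells` (stmt-AtomisticToContinuum-9225).

**Theorem (`measure_event_eq_zero_of_deepPricing`).**  Let `δ > 0` and let `P` be a point-stationary
probability law on rooted `δ`-hard-core configurations of `ℝ³` which is minimising (`E_P[h] ≤ e*`) and
almost surely carried by configurations `count|S` with `K S` (any class `K`).  Let `E` be a measurable set
of configurations ("the event, read at the root") and suppose the DEEP PRICING inequality with constants
`R₀, c > 0`: for every `δ`-separated `S` with `K S`, every finite `C ⊆ S` and every `G ⊆ C` consisting of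
sites `y` at which the event holds after re-rooting (`count|(S − y) ∈ E`) and which are `R₀`-deep in `C`
(`S ∩ B̄(y, R₀) ⊆ C`), one has `#C · e* + c · #G ≤ ½ ∑∑_{C} V_LJ`.  Then `P E = 0`.

Proof: the cluster-periodisation machine of `…EquilibriumInLaw{CellAverage,CellSums,Assembly}` (random
grid of mesh `L` with ONE uniform phase, Mecke cell-average identity, depth penalties `tailBound`), run
with the indicator of `E` in place of the gain event: `P(E) · c L³ ≤ (6 CT + 6 c R₀) L²` for every `L`.
This is the law-level transfer that consumes a FINITE, LINEAR pricing of deep sites and needs neither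
volume growth nor surface tension: the energy and the event are averaged with the same weights.
-/

noncomputable section

open MeasureTheory ProbabilityTheory
open scoped ENNReal BigOperators Classical

namespace Summit.AtomisticToContinuum.Crystallization.Theorems.PalmUnimodularRigidityMinimiserShells.EventTransferCell

open Literature.Probability.Process (IsPointStationaryLaw IsRootedHardCore count_restrict_singleton_ne_zero_iff
  map_sub_count_restrict)
open Literature.MathematicalPhysics.StatisticalMechanics (lennardJones IsMuGSC UniformlyDiscrete)
open Summit.AtomisticToContinuum.Crystallization.Theses.PalmUnimodularRigidity (MinimiserShells UnimodularEnergyLowerBound)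
open Summit.AtomisticToContinuum.Crystallization.Theorems.MinimiserShells.Negative.LoadBearing
  (eStar meanRootEnergy GoodShell minimiserShells_iff)
open Summit.AtomisticToContinuum.Crystallization.Theorems.MinimiserShells.Negative.Rootedness (E3
  countable_of_separated)
open Summit.AtomisticToContinuum.Crystallization.Theorems.PalmUnimodularRigidityMinimiserShells.EquilibriumInLaw.LfKernel
  (lfKernel lfKernel_count_restrict)
open Summit.AtomisticToContinuum.Crystallization.Theorems.PalmUnimodularRigidityMinimiserShells.EquilibriumInLaw.Phase
  (cube cell depth measurableSet_cube measurableSet_cell zero_mem_cell finite_inter_cell measurable_depth depth_nonneg)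
open Summit.AtomisticToContinuum.Crystallization.Theorems.PalmUnimodularRigidityMinimiserShells.EquilibriumInLaw.Lattice
  (latticeL depth_add_of_mem_latticeL volume_cube)
open Summit.AtomisticToContinuum.Crystallization.Theorems.PalmUnimodularRigidityMinimiserShells.EquilibriumInLaw.RootSums
  (Bδ Bδ_nonneg tailBound tailBound_nonneg CT CT_nonneg)
open Summit.AtomisticToContinuum.Crystallization.Theorems.PalmUnimodularRigidityMinimiserShells.EquilibriumInLaw.Cluster
  (tsum_sdiff_coe_eq_sum_add_tsum)
open Summit.AtomisticToContinuum.Crystallization.Theorems.PalmUnimodularRigidityMinimiserShells.EquilibriumInLaw.CellAverage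
  (reroot reroot_eq_map measurable_reroot cellAvg measurable_cellAvg measurable_cellAvgIntegrand lintegral_cellAvg_eq)
open Summit.AtomisticToContinuum.Crystallization.Theorems.PalmUnimodularRigidityMinimiserShells.EquilibriumInLaw.CellSums
  (hTilde Bshift eStar_add_Bshift_nonneg F₁ F₂ measurable_F₁ measurable_F₂ F₁_periodic F₂_periodic
  lintegral_cell_indicator count_restrict_cell cellAvg_count_restrict reroot_count_restrict F₁_reroot abs_tsum_le_Bδ)
open Summit.AtomisticToContinuum.Crystallization.Theorems.PalmUnimodularRigidityMinimiserShells.EquilibriumInLaw.WindowReal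
  (inter_closedBall_subset_cell neg_tailBound_le_tsum)
open Summit.AtomisticToContinuum.Crystallization.Theorems.PalmUnimodularRigidityMinimiserShells.EquilibriumInLaw.Assembly
  (setLIntegral_F₂_le volume_cube_le_deep_add lintegral_cellAvg_F₁ lintegral_cellAvg_F₂ lintegral_ofReal_hTilde_le)

/-! ## The event observable -/

/-- The event observable `(μ, u) ↦ 1_E(μ) · 1[R₀ < depth_L u]` ("the event holds at the root and the root is
deep in its cell") is jointly measurable. -/
theorem measurable_Fev (L R₀ : ℝ) {Ev : Set (Measure E3)} (hE : MeasurableSet Ev) :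
    Measurable (Function.uncurry (fun (μ : Measure E3) (u : E3) => Ev.indicator (1 : Measure E3 → ℝ≥0∞) μ * {u : E3 | R₀ < depth L u}.indicator (1 : E3 → ℝ≥0∞) u)) :=
  ((measurable_one.indicator hE).comp measurable_fst).mul
    ((measurable_one.indicator (measurableSet_lt measurable_const (measurable_depth L))).comp measurable_snd)

/-- The event observable is phase-periodic. -/
theorem Fev_periodic {L : ℝ} (hL : L ≠ 0) (R₀ : ℝ) (Ev : Set (Measure E3)) :
    ∀ μ, ∀ v ∈ latticeL hL, ∀ u, (fun (μ : Measure E3) (u : E3) => Ev.indicator (1 : Measure E3 → ℝ≥0∞) μ * {u : E3 | R₀ < depth L u}.indicator (1 : E3 → ℝ≥0∞) u) μ (u + v) =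
      (fun (μ : Measure E3) (u : E3) => Ev.indicator (1 : Measure E3 → ℝ≥0∞) μ * {u : E3 | R₀ < depth L u}.indicator (1 : E3 → ℝ≥0∞) u) μ u := by
  intro μ v hv u
  simp only [Set.indicator_apply, Set.mem_setOf_eq, depth_add_of_mem_latticeL hL hv, Pi.one_apply]

/-- `E[cellAvg (1_E · 1[deep])] = P(E) · vol{u ∈ cube | R₀ < depth u}`. -/
theorem lintegral_cellAvg_Fev {δ L : ℝ} (hL : 0 < L) (hδ : 0 < δ) {P : Measure (Measure E3)}
    (hcore : ∀ᵐ μ ∂P, IsRootedHardCore δ μ) (hstat : IsPointStationaryLaw P)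
    (R₀ : ℝ) {Ev : Set (Measure E3)} (hE : MeasurableSet Ev) :
    ∫⁻ μ, cellAvg L (fun (μ : Measure E3) (u : E3) => Ev.indicator (1 : Measure E3 → ℝ≥0∞) μ * {u : E3 | R₀ < depth L u}.indicator (1 : E3 → ℝ≥0∞) u) μ ∂P =
      P Ev * (volume.restrict (cube L)) {u : E3 | R₀ < depth L u} := by
  have hm : MeasurableSet {u : E3 | R₀ < depth L u} := measurableSet_lt measurable_const (measurable_depth L)
  rw [lintegral_cellAvg_eq hL hδ hcore hstat (measurable_Fev L R₀ hE) (Fev_periodic hL.ne' R₀ Ev)]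
  have hinner : ∀ μ : Measure E3, (∫⁻ u in cube L, (fun (μ : Measure E3) (u : E3) => Ev.indicator (1 : Measure E3 → ℝ≥0∞) μ * {u : E3 | R₀ < depth L u}.indicator (1 : E3 → ℝ≥0∞) u) μ u) =
      Ev.indicator 1 μ * (volume.restrict (cube L)) {u : E3 | R₀ < depth L u} := by
    intro μ
    rw [lintegral_const_mul _ (measurable_one.indicator hm), lintegral_indicator_one hm]
  simp_rw [hinner]
  rw [lintegral_mul_const _ (measurable_one.indicator hE), lintegral_indicator_one hE]

/-! ## The per-cell real inequality from deep pricing -/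

/-- **The per-cell inequality from deep pricing.**  If deep `E`-sites of finite sub-windows of `S` are
priced at rate `c` beyond depth `R₀`, then for every grid size `L > 0`, phase `u` and the window
`C = S ∩ cell_u`:
`#C · e* + c · #{y ∈ C : R₀ < depth(u − y), θ_y count|S ∈ Ev} ≤ ∑_{y ∈ C} (½ ∑_{z ∈ S} V(|y − z|) + ½ tailBound δ ⌊depth⌋)`. -/
theorem cell_real_inequality {δ : ℝ} (hδ : 0 < δ) {S : Set E3}
    (hsep : ∀ x ∈ S, ∀ z ∈ S, x ≠ z → δ ≤ dist x z) {Ev : Set (Measure E3)} {R₀ c : ℝ}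
    (hprice : ∀ C : Finset E3, (↑C : Set E3) ⊆ S → ∀ G : Finset E3, G ⊆ C →
      (∀ y ∈ G, (Measure.count : Measure E3).restrict ((fun z => z - y) '' S) ∈ Ev ∧
        S ∩ Metric.closedBall y R₀ ⊆ ↑C) →
      (C.card : ℝ) * eStar + c * G.card ≤ (∑ x ∈ C, ∑ z ∈ C, lennardJones (dist x z)) / 2)
    {L : ℝ} (hL : 0 < L) (u : E3) (C : Finset E3) (hC : (↑C : Set E3) = S ∩ cell L u) :
    (C.card : ℝ) * eStar + c * (C.filter fun y => R₀ < depth L (u - y) ∧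
        reroot ((Measure.count : Measure E3).restrict S, y) ∈ Ev).card ≤
      ∑ y ∈ C, ((∑' z : S, lennardJones (dist y z)) / 2 + tailBound δ ⌊depth L (u - y)⌋₊ / 2) := by
  have hCS : (↑C : Set E3) ⊆ S := hC ▸ Set.inter_subset_left
  have hud : UniformlyDiscrete (S \ ↑C) := ⟨δ, hδ, fun x hx z hz hxz => hsep x hx.1 z hz.1 hxz⟩
  -- the deep event sites
  set G := C.filter (fun y => R₀ < depth L (u - y) ∧
    reroot ((Measure.count : Measure E3).restrict S, y) ∈ Ev) with hG
  have hGC : G ⊆ C := Finset.filter_subset _ _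
  have hGdeep : ∀ y ∈ G, (Measure.count : Measure E3).restrict ((fun z => z - y) '' S) ∈ Ev ∧
      S ∩ Metric.closedBall y R₀ ⊆ ↑C := by
    intro y hy
    obtain ⟨hyC, hdep, hev⟩ := Finset.mem_filter.1 hy
    refine ⟨?_, ?_⟩
    · rwa [reroot_count_restrict hδ hsep y] at hev
    · have hycell : y ∈ cell L u := (hC ▸ (Finset.mem_coe.2 hyC) : y ∈ S ∩ cell L u).2
      rw [hC]
      exact inter_closedBall_subset_cell hL hycell hdep
  have key := hprice C hCS G hGC hGdeep
  -- the root energies of the atoms of `C`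
  have hsplit : ∀ y ∈ C, ∑' z : S, lennardJones (dist y z) =
      ∑ z ∈ C, lennardJones (dist y z) + ∑' z : ↥(S \ ↑C), lennardJones (dist y z) := by
    intro y _
    have h := tsum_sdiff_coe_eq_sum_add_tsum hCS (Finset.empty_subset C) (fun z => lennardJones (dist y z))
      (hud.summable_lennardJones y)
    rw [Finset.sdiff_empty] at h
    rw [← h]
    exact tsum_congr_set_coe (fun z => lennardJones (dist y z)) (by rw [Finset.coe_empty, Set.sdiff_empty])
  have htail : ∀ y ∈ C, -tailBound δ ⌊depth L (u - y)⌋₊ ≤ ∑' z : ↥(S \ ↑C), lennardJones (dist y z) :=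
    fun y hy => neg_tailBound_le_tsum hδ hL hsep hC hy
  calc (C.card : ℝ) * eStar + c * G.card ≤ (∑ x ∈ C, ∑ z ∈ C, lennardJones (dist x z)) / 2 := key
    _ ≤ ∑ y ∈ C, ((∑' z : S, lennardJones (dist y z)) / 2 + tailBound δ ⌊depth L (u - y)⌋₊ / 2) := by
        rw [Finset.sum_div]
        refine Finset.sum_le_sum fun y hy => ?_
        rw [hsplit y hy]
        linarith [htail y hy]

/-! ## The pointwise cell inequality -/

/-- **The pointwise cell inequality** for the configuration `count|S` of a rooted `δ`-separated `S`
whose deep `E`-sites are priced: for every `L > 0`,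
`ofReal(e* + Bshift) · vol(cube L) + ofReal(c) · cellAvg L Fev ≤ cellAvg L F₁ + cellAvg L F₂`. -/
theorem pointwise_cell_inequality {δ : ℝ} (hδ : 0 < δ) {S : Set E3} (h0 : (0 : E3) ∈ S)
    (hsep : ∀ x ∈ S, ∀ z ∈ S, x ≠ z → δ ≤ dist x z) {Ev : Set (Measure E3)} (hE : MeasurableSet Ev)
    {R₀ c : ℝ} (hc : 0 < c)
    (hprice : ∀ C : Finset E3, (↑C : Set E3) ⊆ S → ∀ G : Finset E3, G ⊆ C →
      (∀ y ∈ G, (Measure.count : Measure E3).restrict ((fun z => z - y) '' S) ∈ Ev ∧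
        S ∩ Metric.closedBall y R₀ ⊆ ↑C) →
      (C.card : ℝ) * eStar + c * G.card ≤ (∑ x ∈ C, ∑ z ∈ C, lennardJones (dist x z)) / 2)
    {L : ℝ} (hL : 0 < L) :
    ENNReal.ofReal (eStar + Bshift δ) * volume (cube L) +
        ENNReal.ofReal c * cellAvg L (fun (μ : Measure E3) (u : E3) => Ev.indicator (1 : Measure E3 → ℝ≥0∞) μ * {u : E3 | R₀ < depth L u}.indicator (1 : E3 → ℝ≥0∞) u) ((Measure.count : Measure E3).restrict S) ≤
      cellAvg L (F₁ δ) ((Measure.count : Measure E3).restrict S) +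
        cellAvg L (F₂ δ L) ((Measure.count : Measure E3).restrict S) := by
  have hκ := lfKernel_count_restrict hδ hsep
  -- notation for the windows
  set C : E3 → Finset E3 := fun u => (finite_inter_cell hL hδ hsep u).toFinset with hCdef
  have hCcoe : ∀ u, (↑(C u) : Set E3) = S ∩ cell L u := fun u => (finite_inter_cell hL hδ hsep u).coe_toFinset
  have hCne : ∀ u, ((C u).card : ℝ≥0∞) ≠ 0 := by
    intro u h
    have h0C : (0 : E3) ∈ C u := by
      rw [← Finset.mem_coe, hCcoe]; exact ⟨h0, zero_mem_cell L u⟩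
    rw [Nat.cast_eq_zero, Finset.card_eq_zero] at h
    rw [h] at h0C
    exact absurd h0C (Finset.notMem_empty _)
  have hCtop : ∀ u, ((C u).card : ℝ≥0∞) ≠ ∞ := fun u => ENNReal.natCast_ne_top _
  -- the three integrands
  rw [cellAvg_count_restrict hL hδ hsep (F₁ δ), cellAvg_count_restrict hL hδ hsep (F₂ δ L),
    cellAvg_count_restrict hL hδ hsep (fun (μ : Measure E3) (u : E3) => Ev.indicator (1 : Measure E3 → ℝ≥0∞) μ * {u : E3 | R₀ < depth L u}.indicator (1 : E3 → ℝ≥0∞) u)]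
  -- measurability of the integrands in the phase
  have hmeas : ∀ {F : Measure E3 → E3 → ℝ≥0∞}, Measurable (Function.uncurry F) →
      Measurable fun u : E3 => (((C u).card : ℝ≥0∞))⁻¹ *
        ∑ y ∈ C u, F (reroot ((Measure.count : Measure E3).restrict S, y)) (u - y) := by
    intro F hF
    have h := (measurable_cellAvgIntegrand (L := L) hF).comp
      (measurable_const.prodMk measurable_id :
        Measurable fun u : E3 => ((Measure.count : Measure E3).restrict S, u))
    have heq : (fun u : E3 => (((C u).card : ℝ≥0∞))⁻¹ *
        ∑ y ∈ C u, F (reroot ((Measure.count : Measure E3).restrict S, y)) (u - y)) =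
        (fun a : Measure E3 × E3 => (lfKernel a.1 (cell L a.2))⁻¹ *
          ∫⁻ y, (cell L a.2).indicator (fun y => F (reroot (a.1, y)) (a.2 - y)) y ∂(lfKernel a.1)) ∘
          fun u : E3 => ((Measure.count : Measure E3).restrict S, u) := by
      funext u
      simp only [Function.comp_apply, hκ, count_restrict_cell hL hδ hsep u, lintegral_cell_indicator hL hδ hsep u,
        hCdef]
    rw [heq]
    exact h
  -- pointwise in the phase
  have hpw : ∀ u, ENNReal.ofReal (eStar + Bshift δ) + ENNReal.ofReal c *
      ((((C u).card : ℝ≥0∞))⁻¹ * ∑ y ∈ C u,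
        (fun (μ : Measure E3) (u : E3) => Ev.indicator (1 : Measure E3 → ℝ≥0∞) μ * {u : E3 | R₀ < depth L u}.indicator (1 : E3 → ℝ≥0∞) u) (reroot ((Measure.count : Measure E3).restrict S, y)) (u - y)) ≤
      (((C u).card : ℝ≥0∞))⁻¹ * ∑ y ∈ C u, F₁ δ (reroot ((Measure.count : Measure E3).restrict S, y)) (u - y) +
      (((C u).card : ℝ≥0∞))⁻¹ * ∑ y ∈ C u, F₂ δ L (reroot ((Measure.count : Measure E3).restrict S, y)) (u - y) := by
    intro u
    -- the real inequality of the cell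
    have hreal := cell_real_inequality hδ hsep hprice hL u (C u) (hCcoe u)
    set G := (C u).filter (fun y => R₀ < depth L (u - y) ∧
      reroot ((Measure.count : Measure E3).restrict S, y) ∈ Ev) with hG
    -- rewrite the three sums
    have hS1 : ∑ y ∈ C u, F₁ δ (reroot ((Measure.count : Measure E3).restrict S, y)) (u - y) =
        ∑ y ∈ C u, ENNReal.ofReal ((∑' z : S, lennardJones (dist y z)) / 2 + Bshift δ) :=
      Finset.sum_congr rfl fun y _ => F₁_reroot hδ hsep y _
    have hS2 : ∑ y ∈ C u, F₂ δ L (reroot ((Measure.count : Measure E3).restrict S, y)) (u - y) =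
        ∑ y ∈ C u, ENNReal.ofReal (tailBound δ ⌊depth L (u - y)⌋₊) := rfl
    have hS3 : ∑ y ∈ C u, (fun (μ : Measure E3) (u : E3) => Ev.indicator (1 : Measure E3 → ℝ≥0∞) μ * {u : E3 | R₀ < depth L u}.indicator (1 : E3 → ℝ≥0∞) u) (reroot ((Measure.count : Measure E3).restrict S, y)) (u - y) =
        (G.card : ℝ≥0∞) := by
      rw [hG, Finset.natCast_card_filter]
      refine Finset.sum_congr rfl fun y _ => ?_
      simp only [Set.indicator_apply, Set.mem_setOf_eq, Pi.one_apply, mul_ite, mul_one, mul_zero]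
      by_cases h1 : reroot ((Measure.count : Measure E3).restrict S, y) ∈ Ev <;>
        by_cases h2 : R₀ < depth L (u - y) <;> simp [h1, h2]
    rw [hS1, hS2, hS3]
    -- non-negativity of the summands
    have hpos1 : ∀ y ∈ C u, 0 ≤ (∑' z : S, lennardJones (dist y z)) / 2 + Bshift δ := by
      intro y hy
      have hyS : y ∈ S := ((hCcoe u) ▸ (Finset.mem_coe.2 hy) : y ∈ S ∩ cell L u).1
      have hb := abs_tsum_le_Bδ hδ hsep hyS
      rw [abs_le] at hb
      unfold Bshift
      have ha := abs_nonneg eStar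
      linarith [hb.1]
    -- the real inequality, shifted
    have hreal' : ((C u).card : ℝ) * (eStar + Bshift δ) + c * G.card ≤
        ∑ y ∈ C u, (((∑' z : S, lennardJones (dist y z)) / 2 + Bshift δ) + tailBound δ ⌊depth L (u - y)⌋₊) := by
      have h1 : ∑ y ∈ C u, (((∑' z : S, lennardJones (dist y z)) / 2 + Bshift δ) +
          tailBound δ ⌊depth L (u - y)⌋₊) =
          ∑ y ∈ C u, ((∑' z : S, lennardJones (dist y z)) / 2 + tailBound δ ⌊depth L (u - y)⌋₊) +
            (C u).card * Bshift δ := by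
        rw [Finset.sum_add_distrib, Finset.sum_add_distrib, Finset.sum_add_distrib, Finset.sum_const,
          nsmul_eq_mul]
        ring
      have h2 : ∑ y ∈ C u, ((∑' z : S, lennardJones (dist y z)) / 2 + tailBound δ ⌊depth L (u - y)⌋₊ / 2) ≤
          ∑ y ∈ C u, ((∑' z : S, lennardJones (dist y z)) / 2 + tailBound δ ⌊depth L (u - y)⌋₊) :=
        Finset.sum_le_sum fun y _ => by linarith [tailBound_nonneg δ ⌊depth L (u - y)⌋₊]
      rw [h1]
      linarith
    -- pass to `ℝ≥0∞`
    have hofReal := ENNReal.ofReal_le_ofReal hreal'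
    rw [ENNReal.ofReal_add (mul_nonneg (Nat.cast_nonneg _) (eStar_add_Bshift_nonneg δ))
        (mul_nonneg hc.le (Nat.cast_nonneg _)), ENNReal.ofReal_mul (Nat.cast_nonneg _), ENNReal.ofReal_natCast,
      ENNReal.ofReal_mul hc.le, ENNReal.ofReal_natCast,
      ENNReal.ofReal_sum_of_nonneg (fun y hy => add_nonneg (hpos1 y hy) (tailBound_nonneg δ _))] at hofReal
    have hsplit : ∑ y ∈ C u, ENNReal.ofReal (((∑' z : S, lennardJones (dist y z)) / 2 + Bshift δ) +
        tailBound δ ⌊depth L (u - y)⌋₊) =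
        ∑ y ∈ C u, ENNReal.ofReal ((∑' z : S, lennardJones (dist y z)) / 2 + Bshift δ) +
          ∑ y ∈ C u, ENNReal.ofReal (tailBound δ ⌊depth L (u - y)⌋₊) := by
      rw [← Finset.sum_add_distrib]
      exact Finset.sum_congr rfl fun y hy => ENNReal.ofReal_add (hpos1 y hy) (tailBound_nonneg δ _)
    rw [hsplit] at hofReal
    -- divide by the window size
    have hinv := mul_le_mul' (le_refl ((((C u).card : ℝ≥0∞))⁻¹)) hofReal
    rw [mul_add, mul_add, ← mul_assoc, ENNReal.inv_mul_cancel (hCne u) (hCtop u), one_mul, ← mul_assoc,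
      mul_comm ((((C u).card : ℝ≥0∞))⁻¹) (ENNReal.ofReal c), mul_assoc] at hinv
    exact hinv
  -- integrate over the phase cube
  have hI3 := hmeas (measurable_Fev L R₀ hE)
  have hI1 := hmeas (measurable_F₁ δ)
  calc ENNReal.ofReal (eStar + Bshift δ) * volume (cube L) + ENNReal.ofReal c *
        ∫⁻ u in cube L, (((C u).card : ℝ≥0∞))⁻¹ *
          ∑ y ∈ C u, (fun (μ : Measure E3) (u : E3) => Ev.indicator (1 : Measure E3 → ℝ≥0∞) μ * {u : E3 | R₀ < depth L u}.indicator (1 : E3 → ℝ≥0∞) u) (reroot ((Measure.count : Measure E3).restrict S, y)) (u - y)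
      = ∫⁻ u in cube L, (ENNReal.ofReal (eStar + Bshift δ) + ENNReal.ofReal c *
          ((((C u).card : ℝ≥0∞))⁻¹ * ∑ y ∈ C u,
            (fun (μ : Measure E3) (u : E3) => Ev.indicator (1 : Measure E3 → ℝ≥0∞) μ * {u : E3 | R₀ < depth L u}.indicator (1 : E3 → ℝ≥0∞) u) (reroot ((Measure.count : Measure E3).restrict S, y)) (u - y))) := by
        rw [lintegral_add_left measurable_const, setLIntegral_const, lintegral_const_mul _ hI3]
    _ ≤ ∫⁻ u in cube L, ((((C u).card : ℝ≥0∞))⁻¹ *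
          ∑ y ∈ C u, F₁ δ (reroot ((Measure.count : Measure E3).restrict S, y)) (u - y) +
        (((C u).card : ℝ≥0∞))⁻¹ *
          ∑ y ∈ C u, F₂ δ L (reroot ((Measure.count : Measure E3).restrict S, y)) (u - y)) :=
        lintegral_mono fun u => hpw u
    _ = _ := lintegral_add_left hI1 _

/-- Registered stub marker (helper part 02 of `stub_pricingTransfer`, line `equilibrium-in-law-surgery`, reshape r3):
the pointwise cell inequality for a priced event, `pointwise_cell_inequality`, closed form. -/
theorem stub_pricingTransfer_part02 :
    ∀ (δ : ℝ), 0 < δ → ∀ (S : Set (EuclideanSpace ℝ (Fin 3))), (0 : EuclideanSpace ℝ (Fin 3)) ∈ S →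
      (∀ x ∈ S, ∀ z ∈ S, x ≠ z → δ ≤ dist x z) → ∀ (Ev : Set (Measure (EuclideanSpace ℝ (Fin 3)))), MeasurableSet Ev →
      ∀ (R₀ c : ℝ), 0 < c →
      (∀ C : Finset (EuclideanSpace ℝ (Fin 3)), (↑C : Set (EuclideanSpace ℝ (Fin 3))) ⊆ S →
        ∀ G : Finset (EuclideanSpace ℝ (Fin 3)), G ⊆ C →
          (∀ y ∈ G, (Measure.count : Measure (EuclideanSpace ℝ (Fin 3))).restrict ((fun z => z - y) '' S) ∈ Ev ∧
            S ∩ Metric.closedBall y R₀ ⊆ ↑C) →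
          (C.card : ℝ) * eStar + c * G.card ≤ (∑ x ∈ C, ∑ z ∈ C, lennardJones (dist x z)) / 2) →
      ∀ (L : ℝ), 0 < L →
      ENNReal.ofReal (eStar + Bshift δ) * volume (cube L) +
          ENNReal.ofReal c * cellAvg L (fun (μ : Measure (EuclideanSpace ℝ (Fin 3))) (u : EuclideanSpace ℝ (Fin 3)) => Ev.indicator (1 : Measure (EuclideanSpace ℝ (Fin 3)) → ℝ≥0∞) μ * {u : EuclideanSpace ℝ (Fin 3) | R₀ < depth L u}.indicator (1 : EuclideanSpace ℝ (Fin 3) → ℝ≥0∞) u)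
            ((Measure.count : Measure (EuclideanSpace ℝ (Fin 3))).restrict S) ≤
        cellAvg L (F₁ δ) ((Measure.count : Measure (EuclideanSpace ℝ (Fin 3))).restrict S) +
          cellAvg L (F₂ δ L) ((Measure.count : Measure (EuclideanSpace ℝ (Fin 3))).restrict S) :=
  fun _ hδ _ h0 hsep _ hE _ _ hc hprice _ hL => pointwise_cell_inequality hδ h0 hsep hE hc hprice hL

end Summit.AtomisticToContinuum.Crystallization.Theorems.PalmUnimodularRigidityMinimiserShells.EventTransferCell

end
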